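import Literature.Probability.Percolation.FKLoopNestingGaussianLimit
import Literature.Probability.LatticeModels.RandomClusterProofs
import Literature.Probability.LatticeModels.RandomClusterShiftedBoxes
import HarnessLib

/-!
# DKLM Corollary 10 at `q = 1`: the free random-cluster limit is critical bond percolation

Companion of `Literature.Probability.Percolation.FKLoopNestingGaussianLimit` (the named fact
`dklm2026_corollary10`, Duminil-Copin–Kozlowski–Lammers–Manolescu, arXiv:2603.06268, Cor. 10).
That fact is stated for any free infinite-volume random-cluster limit
(`IsFreeRandomClusterLimit (rcSelfDualPoint q) q P`). Here we PROVE that at `q = 1` the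
hypothesis is met by Mathlib's product measure `bondPercolation (zdGraph 2) half` — critical
Bernoulli bond percolation on `ℤ²`, the measure of the consumer route
`Summits/CriticalPhenomena/CardyFormulaZ2/Theses/CardyMagicRigidity.lean` (`MagicFormulaZ2`) — so
that the fact applies to it verbatim (`dklm2026_corollary10.bondPercolation_half`).

Proof: at `q = 1` the free box measure `rcFreeBoxMeasure p 1 n` is the product Bernoulli measure
of the box graph (`rcMeasure_one_eq_bondPercolation_holds`, Grimmett 2006 §1.2); the cylinder
probabilities of a product Bernoulli measure are finite products of one-coordinate masses
(`setBernoulli_cylinder`, via `Measure.infinitePi_pi`); and once the box `Λ_n` contains the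
prescribed pairs (`n ≥ sup pairRad`), the projected cylinder event of the box is the cylinder event
of the lifted pairs (`pieceCylinderEvent_eq_of_sup_le`, lifting along `toBox`/`liftPair`) with
the same factors as on `ℤ²` (`rcFreeBoxMeasure_half_one_pieceCylinderEvent`), so the sequence of
box probabilities is eventually constant (`isFreeRandomClusterLimit_bondPercolation_half`).
Everything here is proved; no named fact is introduced.

## References

* G. Grimmett, *The Random-Cluster Model* (2006), §1.2 pp. 4–6 (`q = 1` is the product measure),
  Thm. (4.19)(a), (6.9).
* H. Duminil-Copin, K. K. Kozlowski, P. Lammers, I. Manolescu, arXiv:2603.06268 (2026), Cor. 10.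
-/

noncomputable section

open MeasureTheory Set Filter
open scoped ENNReal Real Topology

namespace Literature.Probability.Percolation

open LatticeModels RandomPlanarGeometry

/-! ### `q = 1`: critical bond percolation on `ℤ²` is a free random-cluster limit at `(1/2, 1)` -/

section QOne

open ProbabilityTheory

/-- The one-coordinate factor of a product-Bernoulli cylinder probability: the mass that the
coordinate law `p δ_{a} + (1-p) δ_{False}` of `setBer(u, p)` (with `a` = "the coordinate belongs to
`u`") gives to the prescribed value `b`. -/
local notation3 "𝔟[" p ", " a ", " b "]" =>
  ((unitInterval.toNNReal p • Measure.dirac a +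
      unitInterval.toNNReal (unitInterval.symm p) • Measure.dirac False : Measure Prop) {q | q ↔ b})

/-- **Cylinder probabilities of the product Bernoulli measure.** For finite `E₀, S`, the
`setBer(u, p)`-probability that a random set meets `E₀` exactly in `S ∩ E₀` is the product over
`i ∈ E₀` of the one-coordinate masses. [folklore] -/
theorem setBernoulli_cylinder {ι : Type*} (u : Set ι) (p : unitInterval) (E₀ S : Finset ι) :
    setBer(u, p) {s | ∀ i ∈ E₀, (i ∈ s ↔ i ∈ S)} = ∏ i ∈ E₀, 𝔟[p, i ∈ u, i ∈ S] := by
  classical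
  have hpre : (fun q : ι → Prop => {i | q i}) ⁻¹' {s : Set ι | ∀ i ∈ E₀, (i ∈ s ↔ i ∈ S)}
      = Set.pi (E₀ : Set ι) (fun i => {q : Prop | q ↔ i ∈ S}) := by
    ext q
    simp [Set.mem_pi]
  rw [setBernoulli_apply', hpre, Measure.infinitePi_pi _ (fun _ _ => MeasurableSet.of_discrete)]

/-- Cylinder probabilities of critical bond percolation on `ℤ²`. [folklore] -/
theorem bondPercolation_half_cylinderEvent (E₀ S : Finset (Sym2 (Site 2))) :
    bondPercolation (zdGraph 2) half (cylinderEvent E₀ S) =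
      ∏ e ∈ E₀, 𝔟[half, e ∈ (zdGraph 2).edgeSet, e ∈ S] :=
  setBernoulli_cylinder _ _ E₀ S

/-- Send a lattice point into the box `Λ_n` (the point itself when it lies in the box; the
origin otherwise — a junk value never used). [folklore] -/
def toBox (n : ℕ) (x : Site 2) : ↥(box 2 n) :=
  if h : x ∈ box 2 n then ⟨x, h⟩ else ⟨0, by simp [mem_box]⟩

/-- `toBox` is a left inverse of the inclusion. [folklore] -/
@[simp] theorem toBox_val {n : ℕ} (x : ↥(box 2 n)) : toBox n x.1 = x := by
  unfold toBox
  rw [dif_pos x.2]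

/-- On the box, `toBox` is the identity on underlying points. [folklore] -/
theorem val_toBox {n : ℕ} {x : Site 2} (h : x ∈ box 2 n) : (toBox n x).1 = x := by
  unfold toBox
  rw [dif_pos h]

/-- Lift an unordered pair of lattice points to the box. [folklore] -/
def liftPair (n : ℕ) (e : Sym2 (Site 2)) : Sym2 ↥(box 2 n) := e.map (toBox n)

/-- A pair with both points in the box is recovered from its lift. [folklore] -/
theorem map_val_liftPair {n : ℕ} {e : Sym2 (Site 2)} (h : ∀ x ∈ e, x ∈ box 2 n) :
    Sym2.map Subtype.val (liftPair n e) = e := by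
  induction e using Sym2.ind with
  | h x y =>
    rw [liftPair, Sym2.map_mk, Sym2.map_mk, val_toBox (h x (Sym2.mem_mk_left x y)),
      val_toBox (h y (Sym2.mem_mk_right x y))]

/-- The lift of a pair of the box is that pair. [folklore] -/
@[simp] theorem liftPair_map_val {n : ℕ} (e' : Sym2 ↥(box 2 n)) :
    liftPair n (Sym2.map Subtype.val e') = e' := by
  rw [liftPair, Sym2.map_map]
  induction e' using Sym2.ind with
  | h a b => simp

/-- For a pair inside the box, "some open edge of the box projects to `e`" means "the lift of
`e` is open". [folklore] -/
theorem exists_map_val_eq_iff {n : ℕ} {ω : BondConfig ↥(box 2 n)} {e : Sym2 (Site 2)}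
    (h : ∀ x ∈ e, x ∈ box 2 n) : (∃ e' ∈ ω, Sym2.map Subtype.val e' = e) ↔ liftPair n e ∈ ω := by
  constructor
  · rintro ⟨e', he', rfl⟩
    rwa [liftPair_map_val]
  · intro he
    exact ⟨_, he, map_val_liftPair h⟩

/-- The lift is an edge of the box graph iff the pair is an edge of `ℤ²` (both points in the
box). [folklore] -/
theorem liftPair_mem_edgeSet_iff {n : ℕ} {e : Sym2 (Site 2)} (h : ∀ x ∈ e, x ∈ box 2 n) :
    liftPair n e ∈ (finsetGraph (zdGraph 2) (box 2 n)).edgeSet ↔ e ∈ (zdGraph 2).edgeSet := by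
  induction e using Sym2.ind with
  | h x y =>
    have hx : x ∈ box 2 n := h x (Sym2.mem_mk_left x y)
    have hy : y ∈ box 2 n := h y (Sym2.mem_mk_right x y)
    rw [liftPair, Sym2.map_mk, SimpleGraph.mem_edgeSet, SimpleGraph.mem_edgeSet,
      finsetGraph_adj_iff, val_toBox hx, val_toBox hy]

/-- Pairs of `E₀` lie in the box `Λ_n` once `n` exceeds their radii. [folklore] -/
theorem forall_mem_box_of_sup_le {E₀ : Finset (Sym2 (Site 2))} {n : ℕ} (hn : E₀.sup pairRad ≤ n)
    {e : Sym2 (Site 2)} (he : e ∈ E₀) : ∀ x ∈ e, x ∈ box 2 n :=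
  mem_box_of_pairRad_le ((Finset.le_sup he).trans hn)

/-- On large boxes the projected cylinder event is a genuine cylinder event of the box
configuration (in the lifted pairs). [folklore] -/
theorem pieceCylinderEvent_eq_of_sup_le {E₀ : Finset (Sym2 (Site 2))} (S : Finset (Sym2 (Site 2)))
    {n : ℕ} (hn : E₀.sup pairRad ≤ n) :
    pieceCylinderEvent (box 2 n) E₀ S =
      {ω | ∀ i ∈ E₀.image (liftPair n),
        (i ∈ ω ↔ i ∈ (E₀.filter (· ∈ S)).image (liftPair n))} := by
  classical
  ext ω
  simp only [mem_pieceCylinderEvent_iff, Set.mem_setOf_eq, Finset.forall_mem_image]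
  refine forall₂_congr fun e he => ?_
  rw [exists_map_val_eq_iff (forall_mem_box_of_sup_le hn he), Finset.mem_image]
  refine iff_congr Iff.rfl ⟨fun hS => ⟨e, Finset.mem_filter.2 ⟨he, hS⟩, rfl⟩, ?_⟩
  rintro ⟨e₂, he₂, heq⟩
  obtain ⟨he₂E, he₂S⟩ := Finset.mem_filter.1 he₂
  have : e₂ = e := by
    rw [← map_val_liftPair (forall_mem_box_of_sup_le hn he₂E), heq,
      map_val_liftPair (forall_mem_box_of_sup_le hn he)]
  exact this ▸ he₂S

/-- `liftPair n` is injective on the pairs of a large box. [folklore] -/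
theorem liftPair_injOn {E₀ : Finset (Sym2 (Site 2))} {n : ℕ} (hn : E₀.sup pairRad ≤ n) :
    Set.InjOn (liftPair n) E₀ := by
  intro e₁ h₁ e₂ h₂ heq
  rw [← map_val_liftPair (forall_mem_box_of_sup_le hn h₁), heq,
    map_val_liftPair (forall_mem_box_of_sup_le hn h₂)]

/-- **Cylinder probabilities of the free box measure at `q = 1`, `p = 1/2`** agree with those of
critical bond percolation on `ℤ²` as soon as the box contains the prescribed pairs.
[cite: Grimmett2006, §1.2, pp. 4–6 (q = 1 is the product measure)] -/
theorem rcFreeBoxMeasure_half_one_pieceCylinderEvent {E₀ : Finset (Sym2 (Site 2))}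
    (S : Finset (Sym2 (Site 2))) {n : ℕ} (hn : E₀.sup pairRad ≤ n) :
    rcFreeBoxMeasure (1 / 2) 1 n (pieceCylinderEvent (box 2 n) E₀ S) =
      bondPercolation (zdGraph 2) half (cylinderEvent E₀ S) := by
  classical
  have hp : (1 / 2 : ℝ) ∈ Set.Icc (0 : ℝ) 1 := ⟨by norm_num, by norm_num⟩
  have hhalf : Set.projIcc (0 : ℝ) 1 zero_le_one (1 / 2) = half :=
    Subtype.ext (by rw [Set.projIcc_of_mem _ hp]; rfl)
  rw [rcFreeBoxMeasure, rcMeasure_one_eq_bondPercolation_holds _ hp, hhalf,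
    pieceCylinderEvent_eq_of_sup_le S hn, bondPercolation, setBernoulli_cylinder,
    Finset.prod_image (liftPair_injOn hn), bondPercolation_half_cylinderEvent]
  refine Finset.prod_congr rfl fun e he => ?_
  have hbox := forall_mem_box_of_sup_le hn he
  have h1 : (liftPair n e ∈ (finsetGraph (zdGraph 2) (box 2 n)).edgeSet) = (e ∈ (zdGraph 2).edgeSet) :=
    propext (liftPair_mem_edgeSet_iff hbox)
  have h2 : (liftPair n e ∈ (E₀.filter (· ∈ S)).image (liftPair n)) = (e ∈ S) := by
    refine propext ⟨?_, fun hS => Finset.mem_image.2 ⟨e, Finset.mem_filter.2 ⟨he, hS⟩, rfl⟩⟩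
    intro hm
    obtain ⟨e₂, he₂, heq⟩ := Finset.mem_image.1 hm
    obtain ⟨he₂E, he₂S⟩ := Finset.mem_filter.1 he₂
    exact (liftPair_injOn hn he₂E he heq) ▸ he₂S
  rw [h1, h2]

/-- **Critical bond percolation on `ℤ²` is the free infinite-volume random-cluster limit at
`(p, q) = (1/2, 1)`**: the hypothesis `IsFreeRandomClusterLimit (rcSelfDualPoint 1) 1 ·` of
`dklm2026_corollary10` at `q = 1` is satisfied by Mathlib's product measure
`bondPercolation (zdGraph 2) half` (the free box measures at `q = 1` are the product measures of the
boxes, whose cylinder probabilities are eventually constant). [cite: Grimmett2006, §1.2 pp. 4–6 and Thm. (4.19)(a)] -/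
theorem isFreeRandomClusterLimit_bondPercolation_half :
    IsFreeRandomClusterLimit (1 / 2) 1 (bondPercolation (zdGraph 2) half) := by
  refine ⟨inferInstance, fun E₀ S => ?_⟩
  refine (tendsto_const_nhds (x := (bondPercolation (zdGraph 2) half).real (cylinderEvent E₀ S))).congr' ?_
  filter_upwards [Filter.eventually_ge_atTop (E₀.sup pairRad)] with n hn
  rw [measureReal_def, measureReal_def, rcFreeBoxMeasure_half_one_pieceCylinderEvent S hn]

/-- The same, with the parameter written as the self-dual point `p_sd(1)`. [cite: Grimmett2006, (6.9)] -/
theorem isFreeRandomClusterLimit_rcSelfDualPoint_one_bondPercolation_half :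
    IsFreeRandomClusterLimit (rcSelfDualPoint 1) 1 (bondPercolation (zdGraph 2) half) := by
  rw [rcSelfDualPoint_one]
  exact isFreeRandomClusterLimit_bondPercolation_half

/-- **DKLM Corollary 10 for critical bond percolation on `ℤ²`, unconditionally in the measure**:
given the named fact, for every finite-energy generalised test function `φ`,
`E_{1/2}[∏_u 2cos(φ(int u) + π/3)] → exp((3/4π²) ∬ log|x−y| dφ dφ)` as `δ → 0⁺`, the expectation
being over Bernoulli(1/2) bond percolation `bondPercolation (zdGraph 2) half` — the measure of the
consumer route `CardyFormulaZ2/CardyMagicRigidity` (`MagicFormulaZ2`).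
[cite: DuminilCopinKozlowskiLammersManolescu2026, Cor. 10 (q = 1)] -/
theorem dklm2026_corollary10.bondPercolation_half (h : dklm2026_corollary10) {φ : SignedMeasure ℂ}
    (hφ : IsGeneralisedTestFunction φ) (hE : HasFiniteDirichletEnergy φ) :
    Tendsto
      (fun δ : ℝ ↦ ∫ ω, (∏ᶠ u ∈ (bondLoopConfig δ 0 ω).F 0 ∪ (bondLoopConfig δ 0 ω).F 1,
        2 * Real.cos (φ {z | u.wind z ≠ 0} + π / 3)) ∂(bondPercolation (zdGraph 2) half))
      (𝓝[>] 0)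
      (𝓝 (Real.exp (3 / (4 * π ^ 2) *
        signedIntegral φ fun x ↦ signedIntegral φ fun y ↦ Real.log ‖x - y‖))) :=
  h.q_one isFreeRandomClusterLimit_bondPercolation_half hφ hE

end QOne

end Literature.Probability.Percolation

end
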